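import Summits.BirchSwinnertonDyer.BirchSwinnertonDyer.Theorems.BiquadraticEisensteinDescentHeegnerTwistCouplingInSupplySqrtTwoCornerSeven
import Summits.BirchSwinnertonDyer.BirchSwinnertonDyer.Theorems.BiquadraticEisensteinDescentHeegnerTwistCouplingInSupplySqrtTwoDualFifteen
import HarnessLib

set_option linter.dupNamespace false -- `Summit.BirchSwinnertonDyer.BirchSwinnertonDyer.Theorems.…` (summit = sub)
set_option autoImplicit false

/-!
# Crux `HeegnerTwistCouplingInSupply` (stmt-BirchSwinnertonDyer-21381) — card `sqrt2-isogeny-heegner-pin`, the DUAL member on the third cell: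
# CELL-7′ for `B_{2pℓ} : y² = x³ + 8pℓ x² + 8p²ℓ² x` (`p ≡ 5 (mod 8)`, `ℓ ≡ 7 (mod 8)` with `x⁴ − 4x² + 2` rootless mod `ℓ`, `(p/ℓ) = +1`) —
# UNCONDITIONAL — and the pin-free rungs `K′ = ℚ(√−ℓ₀)`, `ℓ₀ ∈ {7, 23, 71, 103, 151}`, for `W = B_{−2p}`, modulo Burungale–Tian + Deuring–Hecke

Route `BiquadraticEisensteinDescent` (cell `pub/bsd-wall`, width seat `bsd-wall-cm-bed-w2` g12; `--supports` 21381, helper). Twin of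
`…SqrtTwoCellSeven` / `…SqrtTwoCornerSeven` (this seat, `W = B_p`) for the other root-number `−1` member `W = B_{−2p} = ⟨0, −8p, 0, 8p², 0⟩`:
`B_{−2p}^{(−ℓ)} = B_{2m}`, `m = pℓ`, whose `φ̂`-set `S(8m, 8m²)` IS the `φ`-set of `B_{−m}` on the third cell (`…SqrtTwoCellSeven.mem_twoIsogenySelmerGroup_phi`)
and whose `φ`-set `S(−16m, 32m²)` dies by the `(2/p) = −1` law (`p`-classes, `(α, β, c) = (−16, 32, 8)`), the backwards `2 ± √2` law at `ℓ`
(classes `ℓ, 2ℓ`: square parameters `4p`, `2p`) and the real place (negative classes).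

* §1 `not_isSoluble_padic_dual_at_ell`; §2 `mem_twoIsogenySelmerGroup_dual_phi` (**`S(−16m, 32m²) ⊆ {1, 2}`**), ★ `rank_eq_zero_and_sha_two_dual`,
  ★ `selmerCorank_two_dual_eq_zero` (**rank 0, `Ш[2] = 0`, `corank₂ = 0` for `B_{2pℓ}`**, unconditional);
* §3 ★ `cruxOnBdualCornerPrime_of_two_facts` (generic rung for `W = B_{−2p}`: `K′ = ℚ(√−ℓ)`), ★★ `cruxOnBdualCornerRungs_of_two_facts`
  (`ℓ₀ ∈ {7, 23, 71, 103, 151}`: the conclusion of crux 21381 for `W = B_{−2p}`, every prime `p ≡ 5 (mod 8)`, `p ≠ 5`, with `(p/ℓ₀) = +1` for one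
  of them; rung `7` = `p ≡ 1, 2, 4 (mod 7)`), modulo `hBT` + `hH` only. The binders `IsGloballyMinimal`, `NeZero N` mirror the crux and are unused.

HONEST FRAMING: typed sub-corner theorems on ONE CM family; C⁺ untouched; crux 21381 NOT closed; BSD is not proved by any of this.
THEOREMS ONLY; supports stmt-BirchSwinnertonDyer-21381.
-/

noncomputable section

open scoped Classical

namespace Summit.BirchSwinnertonDyer.BirchSwinnertonDyer.Theorems.BiquadraticEisensteinDescentHeegnerTwistCouplingInSupplySqrtTwoDualSeven

open _root_.WeierstrassCurve Literature.NumberTheory.EllipticCurves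
open Summit.BirchSwinnertonDyer.BirchSwinnertonDyer.Theorems.GoldfeldGoodTwists (mordellWeilRank_congr forall_mem_sha_two_congr)
open Summit.BirchSwinnertonDyer.BirchSwinnertonDyer.Theorems.BiquadraticEisensteinDescentHeegnerTwistCouplingInSupplySqrtTwoCell
  (not_isSoluble_padic_of_prime_factor not_dvd_two_pow_of_odd_prime natAbs_eq_one_or_two_of_squarefree)
open Summit.BirchSwinnertonDyer.BirchSwinnertonDyer.Theorems.BiquadraticEisensteinDescentHeegnerTwistCouplingInSupplySqrtTwoCellFifteenLocal
  (not_isSoluble_padic_of_dvd_of_rootless rootless_both_of_rootless)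
open Summit.BirchSwinnertonDyer.BirchSwinnertonDyer.Theorems.BiquadraticEisensteinDescentHeegnerTwistCouplingInSupplySqrtTwoCellFifteen
  (eq_of_squarefree_of_prime_factors)
open Summit.BirchSwinnertonDyer.BirchSwinnertonDyer.Theorems.BiquadraticEisensteinDescentHeegnerTwistCouplingInSupplySqrtTwoCellSeven
  (rootless_of_sq pos_squarefree_odd mem_twoIsogenySelmerGroup_phi)
open Summit.BirchSwinnertonDyer.BirchSwinnertonDyer.Theorems.BiquadraticEisensteinDescentHeegnerTwistCouplingInSupplySqrtTwoCornerSeven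
  (rootless_seven)
open Summit.BirchSwinnertonDyer.BirchSwinnertonDyer.Theorems.BiquadraticEisensteinDescentHeegnerTwistCouplingInSupplySqrtTwoDual
  (dvd_of_prime_dvd_of_dvd_thirtytwo_mul_sq twoIsogenySelmerGroup'_dual hab_dual lit_dual isElliptic_dual
    eq_two_or_eq_of_prime_dvd_conductorNorm_Bdual)
open Summit.BirchSwinnertonDyer.BirchSwinnertonDyer.Theorems.BiquadraticEisensteinDescentHeegnerTwistCouplingInSupplySqrtTwoDualFifteen
  (L_one_ne_zero_dual_of_selmerCorank)
open Summit.BirchSwinnertonDyer.BirchSwinnertonDyer.Theorems.BiquadraticEisensteinDescentHeegnerTwistCouplingInSupplySizeIndivisibleSharp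
  (classNumber_le_ten_of_natAbs_discr_le)

/-! ## §1 At the twisting prime `ℓ`, the `φ`-set `S(−16m, 32m²)` of `B_{2m}`: classes `ℓ, 2ℓ` -/

section Local

variable {ℓ : ℕ} [Fact ℓ.Prime]

/-- **`φ`-classes `d = ℓ, 2ℓ` of `B_{2m}` at `ℓ`** (`m = ℓc`, `c` and `2` nonzero squares mod `ℓ`, `x⁴ − 4x² + 2` rootless mod `ℓ`): the spaces
`w² = ℓ u⁴ − 16m u²z² + 32ℓc² z⁴` and `w² = 2ℓ u⁴ − 16m u²z² + 16ℓc² z⁴` have no `ℚ_ℓ`-point — reduced quartics `t⁴ − 4(4c)t² + 2(4c)²` and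
`2(t⁴ − 4(2c)t² + 2(2c)²)` with square parameters `4c = (2y)²`, `2c = (√2·y)²`. [cite: SilvermanAEC2009, Prop. X.4.9 (local conditions on C_d)] -/
theorem not_isSoluble_padic_dual_at_ell (hroot : ∀ x : ZMod ℓ, x ^ 4 - 4 * x ^ 2 + 2 ≠ 0) (h2 : IsSquare (2 : ZMod ℓ))
    {m c : ℤ} (hm : m = ℓ * c) (hc : IsSquare (c : ZMod ℓ)) (hc0 : (c : ZMod ℓ) ≠ 0) :
    ¬ ((twoIsogenyQuartic (-16 * m) ℓ (32 * ℓ * c ^ 2)).map (Int.castRingHom ℚ_[ℓ])).IsSoluble ∧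
      ¬ ((twoIsogenyQuartic (-16 * m) (2 * ℓ) (16 * ℓ * c ^ 2)).map (Int.castRingHom ℚ_[ℓ])).IsSoluble := by
  obtain ⟨y, hy⟩ := hc
  have hy0 : y ≠ 0 := by rintro rfl; exact hc0 (by rw [hy, mul_zero])
  have hc' : (c : ZMod ℓ) = y ^ 2 := by rw [hy, pow_two]
  obtain ⟨s, hs⟩ := h2
  have hs2 : s ^ 2 = 2 := by rw [pow_two, ← hs]
  have h20 : (2 : ZMod ℓ) ≠ 0 := fun h0 => hroot 0 (by rw [h0]; ring)
  have hs0 : s ≠ 0 := by rintro rfl; exact h20 (by rw [← hs2]; ring)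
  constructor
  · refine not_isSoluble_padic_of_dvd_of_rootless (A₁ := -16 * c) (d₁ := 1) (e₁ := 32 * c ^ 2)
      (by rw [hm]; ring) (by ring) (by ring) (rootless_both_of_rootless (by norm_num) fun t ht => ?_)
    push_cast at ht
    exact rootless_of_sq hroot (c := 4 * (c : ZMod ℓ)) (y := 2 * y) (by rw [hc']; ring) (mul_ne_zero h20 hy0) t
      (by linear_combination ht)
  · refine not_isSoluble_padic_of_dvd_of_rootless (A₁ := -16 * c) (d₁ := 2) (e₁ := 16 * c ^ 2)
      (by rw [hm]; ring) (by ring) (by ring) (rootless_both_of_rootless (by exact_mod_cast h20) fun t ht => ?_)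
    push_cast at ht
    have h2inv : (2 : ZMod ℓ)⁻¹ * 2 = 1 := inv_mul_cancel₀ h20
    exact rootless_of_sq hroot (c := 2 * (c : ZMod ℓ)) (y := s * y) (by rw [hc', mul_pow, hs2]) (mul_ne_zero hs0 hy0) t
      (by linear_combination (2 : ZMod ℓ)⁻¹ * ht - (t ^ 4 - 4 * (2 * (c : ZMod ℓ)) * t ^ 2 + 2 * (2 * (c : ZMod ℓ)) ^ 2) * h2inv)

end Local

/-! ## §2 CELL-7′: `S(−16m, 32m²) ⊆ {1, 2}`, rank, `Ш[2]`, corank for `B_{2m}`, `m = pℓ` -/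

section Cell

variable {p ℓ : ℕ} {m : ℤ}

/-- **CELL-7′, `φ`-set of `B_{2m}`: `S(−16m, 32m²) ⊆ {1, 2}`** for `m = pℓ`, `p ≡ 5 (8)`, `ℓ ≡ 7 (8)` with `x⁴ − 4x² + 2` rootless mod `ℓ`, `(p/ℓ) = +1`:
`p`-classes die `p`-adically (`(2/p) = −1`, `(α, β, c) = (−16, 32, 8)`), `ℓ, 2ℓ` die `ℓ`-adically (§1), negative classes die over `ℝ`.
[cite: SilvermanAEC2009, Prop. X.4.9] -/
theorem mem_twoIsogenySelmerGroup_dual_phi (hp : p.Prime) (hp8 : p % 8 = 5) (hℓ : ℓ.Prime) (hℓ8 : ℓ % 8 = 7)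
    (hroot : ∀ x : ZMod ℓ, x ^ 4 - 4 * x ^ 2 + 2 ≠ 0) (hsq : IsSquare (p : ZMod ℓ)) (hm : m = p * ℓ) {d : ℤ}
    (h : d ∈ twoIsogenySelmerGroup (-16 * m) (32 * m ^ 2)) : d = 1 ∨ d = 2 := by
  haveI : Fact p.Prime := ⟨hp⟩
  haveI : Fact ℓ.Prime := ⟨hℓ⟩
  obtain ⟨hm0, hmsq, -, hpl⟩ := pos_squarefree_odd hp hp8 hℓ hℓ8 hm
  have hℓ0 : (ℓ : ℤ) ≠ 0 := by exact_mod_cast hℓ.ne_zero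
  have hb : (32 * m ^ 2 : ℤ) ≠ 0 := by positivity
  obtain ⟨hsqd, hdvd, hloc⟩ := (mem_twoIsogenySelmerGroup_iff hb).mp h
  have hneg : ∀ {d : ℤ}, d < 0 → d ∣ 32 * m ^ 2 → (twoIsogenyQuartic (-16 * m) d (32 * m ^ 2 / d)).IsLocallySoluble → False :=
    fun {d} hd0 hdvd hloc => by
      have hmul : d * (32 * m ^ 2 / d) = 32 * m ^ 2 := Int.mul_ediv_cancel' hdvd
      have hd'0 : 32 * m ^ 2 / d < 0 := by
        by_contra hq
        push Not at hq
        nlinarith [mul_nonneg (neg_pos.mpr hd0).le hq, mul_pos hm0 hm0]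
      exact not_isSoluble_real_twoIsogenyQuartic_of_neg hd0 hd'0 (by omega) hloc.1
  by_cases hpd : (p : ℤ) ∣ d
  · exfalso
    exact not_isSoluble_padic_of_prime_factor (r := p) (Or.inr hp8) (α := -16) (β := 32) (c := 8) (by norm_num)
      (by simpa using not_dvd_two_pow_of_odd_prime hp (by rintro rfl; omega) (k := 3)) hmsq (by rw [hm]; exact dvd_mul_right _ _)
      hsqd hpd hdvd (hloc.2 p)
  · have hfac : ∀ q : ℕ, q.Prime → (q : ℤ) ∣ d → q = 2 ∨ q = ℓ := fun q hq hqd => by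
      by_cases hq2 : q = 2
      · exact Or.inl hq2
      · have hqm : (q : ℤ) ∣ m := dvd_of_prime_dvd_of_dvd_thirtytwo_mul_sq hq hq2 hqd hdvd
        rw [hm] at hqm
        rcases (Nat.prime_iff_prime_int.mp hq).dvd_or_dvd hqm with h1 | h1
        · exact absurd (((Nat.prime_dvd_prime_iff_eq hq hp).mp (Int.natCast_dvd_natCast.mp h1)) ▸ hqd) hpd
        · exact Or.inr ((Nat.prime_dvd_prime_iff_eq hq hℓ).mp (Int.natCast_dvd_natCast.mp h1))
    by_cases hℓd : (ℓ : ℤ) ∣ d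
    · have hc0 : ((p : ℤ) : ZMod ℓ) ≠ 0 := by
        rw [Ne, ZMod.intCast_zmod_eq_zero_iff_dvd, Int.natCast_dvd_natCast]
        exact fun h1 => hpl ((Nat.prime_dvd_prime_iff_eq hℓ hp).mp h1).symm
      obtain ⟨h1, h2⟩ := not_isSoluble_padic_dual_at_ell hroot ((ZMod.exists_sq_eq_two_iff (by rintro rfl; omega)).mpr (Or.inr hℓ8))
        (m := m) (c := p) (by rw [hm]; ring) (by exact_mod_cast hsq) hc0
      rcases eq_of_squarefree_of_prime_factors hℓ hsqd hℓd hfac with rfl | rfl | rfl | rfl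
      · exfalso; refine h1 ?_
        have := hloc.2 ℓ
        rwa [show (32 * m ^ 2 : ℤ) / ℓ = 32 * ℓ * (p : ℤ) ^ 2 by
          rw [show (32 * m ^ 2 : ℤ) = ℓ * (32 * ℓ * (p : ℤ) ^ 2) by rw [hm]; ring]
          exact Int.mul_ediv_cancel_left _ hℓ0] at this
      · exfalso; refine h2 ?_
        have := hloc.2 ℓ
        rwa [show (32 * m ^ 2 : ℤ) / (2 * ℓ) = 16 * ℓ * (p : ℤ) ^ 2 by
          rw [show (32 * m ^ 2 : ℤ) = (2 * ℓ) * (16 * ℓ * (p : ℤ) ^ 2) by rw [hm]; ring]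
          exact Int.mul_ediv_cancel_left _ (mul_ne_zero two_ne_zero hℓ0)] at this
      · exact (hneg (by simp [hℓ.pos]) hdvd hloc).elim
      · exact (hneg (by simp [hℓ.pos]) hdvd hloc).elim
    · have habs := natAbs_eq_one_or_two_of_squarefree hsqd fun q hq hqd => by
        rcases hfac q hq hqd with h2 | hl
        · exact h2
        · exact absurd (hl ▸ hqd) hℓd
      rcases Int.natAbs_eq d with hpos | hneg'
      · rcases habs with h1 | h2 <;> omega
      · exact (hneg (by rcases habs with h1 | h2 <;> omega) hdvd hloc).elim

/-- Arithmetic core: `2^{r+2}·(n₁ n₂) ≤ 4` with the product positive forces `r = 0`, `n₁ = n₂ = 1`. [folklore] -/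
private theorem rank_zero_arith {r n₁ n₂ : ℕ} (h4 : 2 ^ (r + 2) * (n₁ * n₂) ≤ 4) (hpos : 0 < 2 ^ (r + 2) * (n₁ * n₂)) :
    r = 0 ∧ n₁ = 1 ∧ n₂ = 1 := by
  have hn : 0 < n₁ * n₂ := Nat.pos_of_ne_zero (by rintro h0; rw [h0, mul_zero] at hpos; exact lt_irrefl 0 hpos)
  have hn₁ : 0 < n₁ := Nat.pos_of_ne_zero (by rintro rfl; simp at hn)
  have hn₂ : 0 < n₂ := Nat.pos_of_ne_zero (by rintro rfl; simp at hn)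
  have h2 : 2 ^ (r + 2) ≤ 4 := le_trans (Nat.le_mul_of_pos_right _ hn) h4
  have hr : r = 0 := by
    by_contra hr
    have h8 : 2 ^ 3 ≤ 2 ^ (r + 2) := Nat.pow_le_pow_right (by norm_num) (by omega)
    omega
  subst hr
  norm_num at h4
  refine ⟨rfl, ?_, ?_⟩ <;> nlinarith

/-- ★ **CELL-7′: `rank B_{2m}(ℚ) = 0` and `Ш(B_{2m}/ℚ)[2] = 0`** for `m = pℓ` on the third cell — UNCONDITIONAL (`#S(8m,8m²) ≤ 2` by
`…SqrtTwoCellSeven.mem_twoIsogenySelmerGroup_phi`, `#S(−16m,32m²) ≤ 2` by §2). [cite: SilvermanAEC2009, Thm. X.4.2(a), Prop. X.4.9] -/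
theorem rank_eq_zero_and_sha_two_dual (hp : p.Prime) (hp8 : p % 8 = 5) (hℓ : ℓ.Prime) (hℓ8 : ℓ % 8 = 7)
    (hroot : ∀ x : ZMod ℓ, x ^ 4 - 4 * x ^ 2 + 2 ≠ 0) (hsq : IsSquare (p : ZMod ℓ)) (hm : m = p * ℓ) :
    (⟨0, 8 * (m : ℚ), 0, 8 * (m : ℚ) ^ 2, 0⟩ : WeierstrassCurve ℚ).mordellWeilRank = 0 ∧
      ∀ c ∈ (⟨0, 8 * (m : ℚ), 0, 8 * (m : ℚ) ^ 2, 0⟩ : WeierstrassCurve ℚ).sha, 2 • c = 0 → c = 0 := by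
  have hm0 : 0 < m := (pos_squarefree_odd hp hp8 hℓ hℓ8 hm).1
  have hab := hab_dual hm0.ne'
  haveI := isElliptic_halfModel hab
  haveI := isElliptic_mk_of_ne_zero (F := ℚ) hab
  haveI := isElliptic_dual hm0.ne'
  have key := two_pow_twoIsogenySelmerRank_add_eq hab
  have hS : (twoIsogenySelmerGroup (8 * m) (8 * m ^ 2)).card ≤ 2 :=
    le_trans (Finset.card_le_card fun d hd => by
      have := mem_twoIsogenySelmerGroup_phi hp hp8 hℓ hℓ8 hroot hsq hm hd
      simp only [Finset.mem_insert, Finset.mem_singleton]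
      exact this) (Finset.card_le_two (a := (1 : ℤ)) (b := 2))
  have hS' : (twoIsogenySelmerGroup' (8 * m) (8 * m ^ 2)).card ≤ 2 := by
    rw [twoIsogenySelmerGroup'_dual]
    exact le_trans (Finset.card_le_card fun d hd => by
      have := mem_twoIsogenySelmerGroup_dual_phi hp hp8 hℓ hℓ8 hroot hsq hm hd
      simp only [Finset.mem_insert, Finset.mem_singleton]
      exact this) (Finset.card_le_two (a := (1 : ℤ)) (b := 2))
  have h4 : 2 ^ (twoIsogenySelmerRank (8 * m) (8 * m ^ 2) + twoIsogenySelmerRank' (8 * m) (8 * m ^ 2)) ≤ 4 := by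
    rw [pow_add, two_pow_twoIsogenySelmerRank_eq_card hab, two_pow_twoIsogenySelmerRank'_eq_card hab]
    exact Nat.mul_le_mul hS hS'
  rw [key] at h4
  obtain ⟨hr, h₁, h₂⟩ := rank_zero_arith h4 (by rw [← key]; exact pow_pos two_pos _)
  have hsha := forall_mem_sha_two_smul_eq_zero_of_halfModel (AddSubgroup.eq_bot_of_card_eq _ h₁)
    (AddSubgroup.eq_bot_of_card_eq _ h₂)
  refine ⟨?_, forall_mem_sha_two_congr (lit_dual m).symm hsha⟩
  rw [← mordellWeilRank_congr (lit_dual m)]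
  exact hr

/-- ★ **CELL-7′, corank form: `corank_{ℤ₂} Sel_{2^∞}(B_{2m}/ℚ) = 0`** on the third cell. The instance argument is `…SqrtTwoDual.isElliptic_dual`.
[cite: SilvermanAEC2009, Thm. X.4.2(a) and Prop. X.4.9] [cite: Greenberg1999, §1] -/
theorem selmerCorank_two_dual_eq_zero (hp : p.Prime) (hp8 : p % 8 = 5) (hℓ : ℓ.Prime) (hℓ8 : ℓ % 8 = 7)
    (hroot : ∀ x : ZMod ℓ, x ^ 4 - 4 * x ^ 2 + 2 ≠ 0) (hsq : IsSquare (p : ZMod ℓ)) (hm : m = p * ℓ)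
    [hE : (⟨0, 8 * (m : ℚ), 0, 8 * (m : ℚ) ^ 2, 0⟩ : WeierstrassCurve ℚ).IsElliptic] :
    (⟨0, 8 * (m : ℚ), 0, 8 * (m : ℚ) ^ 2, 0⟩ : WeierstrassCurve ℚ).selmerCorank 2 = 0 := by
  haveI : Fact (Nat.Prime 2) := ⟨Nat.prime_two⟩
  obtain ⟨hr, hsha⟩ := rank_eq_zero_and_sha_two_dual hp hp8 hℓ hℓ8 hroot hsq hm
  rw [(⟨0, 8 * (m : ℚ), 0, 8 * (m : ℚ) ^ 2, 0⟩ : WeierstrassCurve ℚ).selmerCorank_eq_mordellWeilRank_add_holds 2, hr,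
    (⟨0, 8 * (m : ℚ), 0, 8 * (m : ℚ) ^ 2, 0⟩ : WeierstrassCurve ℚ).shaCorank_eq_zero_of_forall 2 hsha]

end Cell

/-! ## §3 Pin-free rungs for `W = B_{−2p}`, `p ≡ 5 (mod 8)` -/

section Rungs

/-- ★ **Generic pin-free rung for `W = B_{−2p}`**: `p ≡ 5 (8)`, `p ≠ 5`, `ℓ ≡ 7 (8)` prime with `ℓ ≤ 166`, `x⁴ − 4x² + 2` rootless mod `ℓ`, `(p/ℓ) = +1`
⇒ `K′ = ℚ(√−ℓ)` is Heegner for `N(B_{−2p})` (prime support `{2, p}`), `4 < |d|`, `L(B_{−2p}^{(−ℓ)}, 1) = L(B_{2pℓ}, 1) ≠ 0` (CELL-7′ + Burungale–Tian +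
Deuring–Hecke), `h(K′) ≤ 10 < p`, `p ∤ h(K′)`. [cite: BurungaleTian2026, Thm. 1.1] [cite: SilvermanAEC2009, Prop. X.4.9] [cite: Cox2013, §7.B Thm. 7.7(ii)] -/
theorem cruxOnBdualCornerPrime_of_two_facts (hBT : burungaleTian_analyticRank_eq_zero_of_selmerCorank_eq_zero_of_hasCM)
    (hH : hasEntireLFunction_of_j_mem_maximalCMJInvariants) {p ℓ : ℕ} (hp : p.Prime) (hp8 : p % 8 = 5) (h5 : p ≠ 5)
    (hℓ : ℓ.Prime) (hℓ8 : ℓ % 8 = 7) (hℓ166 : ℓ ≤ 166) (hroot : ∀ x : ZMod ℓ, x ^ 4 - 4 * x ^ 2 + 2 ≠ 0)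
    (hJ : jacobiSym (p : ℤ) ℓ = 1) [(⟨0, -8 * (p : ℚ), 0, 8 * (p : ℚ) ^ 2, 0⟩ : WeierstrassCurve ℚ).IsElliptic] :
    ∃ (K : Type) (_ : Field K) (_ : NumberField K),
      IsImaginaryQuadratic K ∧ NumberField.discr K = -(ℓ : ℤ) ∧ 4 < (NumberField.discr K).natAbs ∧
      SatisfiesHeegnerHypothesis ((⟨0, -8 * (p : ℚ), 0, 8 * (p : ℚ) ^ 2, 0⟩ : WeierstrassCurve ℚ).conductorNorm ℤ) K ∧
      ((⟨0, -8 * (p : ℚ), 0, 8 * (p : ℚ) ^ 2, 0⟩ : WeierstrassCurve ℚ).quadraticTwist (NumberField.discr K : ℚ)).entireLFunction 1 ≠ 0 ∧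
      NumberField.classNumber K < p ∧ ¬ p ∣ NumberField.classNumber K := by
  haveI : Fact p.Prime := ⟨hp⟩
  haveI : Fact ℓ.Prime := ⟨hℓ⟩
  haveI : Fact ((-(ℓ : ℤ)) < 0) := ⟨by have := hℓ.pos; omega⟩
  have hp13 : 13 ≤ p := by omega
  have hpl : p ≠ ℓ := by rintro rfl; omega
  have hsf : Squarefree (-(ℓ : ℤ)).natAbs := by
    rw [Int.natAbs_neg, Int.natAbs_natCast]; exact hℓ.squarefree
  have hD8 : (-(ℓ : ℤ)) % 8 = 1 := by omega
  obtain ⟨hK, hdK⟩ := isImaginaryQuadratic_and_discr_sqrtField_of_squarefree_natAbs (-(ℓ : ℤ)) (by omega) hsf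
  have hJ' : jacobiSym (ℓ : ℤ) p = 1 := by
    rw [← jacobiSym.quadratic_reciprocity_one_mod_four (by omega) (Nat.odd_iff.mpr (by omega))]; exact hJ
  have hJneg : jacobiSym (-(ℓ : ℤ)) p = 1 := by
    rw [jacobiSym.neg _ (Nat.odd_iff.mpr (by omega)), ZMod.χ₄_nat_one_mod_four (by omega), hJ', one_mul]
  have hp0 : ((p : ℤ) : ZMod ℓ) ≠ 0 := by
    rw [Ne, ZMod.intCast_zmod_eq_zero_iff_dvd, Int.natCast_dvd_natCast]
    exact fun h => hpl ((Nat.prime_dvd_prime_iff_eq hℓ hp).mp h).symm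
  have hsq : IsSquare (p : ZMod ℓ) := by
    have h := (legendreSym.eq_one_iff ℓ hp0).mp (by rw [jacobiSym.legendreSym.to_jacobiSym]; exact hJ)
    simpa using h
  set m : ℤ := (p : ℤ) * (ℓ : ℤ) with hm
  have hm0 : 0 < m := by have := hp.pos; have := hℓ.pos; positivity
  have htw : (⟨0, -8 * (p : ℚ), 0, 8 * (p : ℚ) ^ 2, 0⟩ : WeierstrassCurve ℚ).quadraticTwist ((-(ℓ : ℤ) : ℤ) : ℚ) =
      ⟨0, 8 * (m : ℚ), 0, 8 * (m : ℚ) ^ 2, 0⟩ := by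
    rw [quadraticTwist_mk, hm]; push_cast; ext <;> simp <;> ring
  haveI := isElliptic_dual hm0.ne'
  have hL := L_one_ne_zero_dual_of_selmerCorank hBT hH hm0.ne' (selmerCorank_two_dual_eq_zero hp hp8 hℓ hℓ8 hroot hsq hm)
  have h10 : NumberField.classNumber (sqrtField (-(ℓ : ℤ))) ≤ 10 :=
    classNumber_le_ten_of_natAbs_discr_le hK (by rw [hdK, Int.natAbs_neg, Int.natAbs_natCast]; exact hℓ166)
  refine ⟨sqrtField (-(ℓ : ℤ)), inferInstance, inferInstance, hK, hdK, ?_, ?_, ?_, by omega, fun hdvd =>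
    absurd (Nat.le_of_dvd (NumberField.classNumber_pos _) hdvd) (by omega)⟩
  · rw [hdK, Int.natAbs_neg, Int.natAbs_natCast]; omega
  · refine satisfiesHeegnerHypothesis_sqrtField_of_squarefree_natAbs _ hD8 hsf fun q hq hqN => ?_
    rcases eq_two_or_eq_of_prime_dvd_conductorNorm_Bdual hp hq hqN with rfl | rfl
    · exact Or.inl rfl
    · exact Or.inr hJneg
  · rw [hdK, htw]; exact hL

/-- ★★ **Pin-free rungs for `W = B_{−2p}`**: every prime `p ≡ 5 (mod 8)`, `p ≠ 5`, with `(p/ℓ₀) = +1` for some `ℓ₀ ∈ {7, 23, 71, 103, 151}` gets the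
conclusion of crux 21381 for `W = B_{−2p}` with `K′ = ℚ(√−ℓ₀)`, modulo Burungale–Tian + Deuring–Hecke only (rung `7` = `p ≡ 1, 2, 4 (mod 7)`).
The binders `IsGloballyMinimal`, `NeZero N` mirror the crux and are unused. [cite: BurungaleTian2026, Thm. 1.1] [cite: SilvermanAEC2009, Prop. X.4.9] -/
theorem cruxOnBdualCornerRungs_of_two_facts (hBT : burungaleTian_analyticRank_eq_zero_of_selmerCorank_eq_zero_of_hasCM)
    (hH : hasEntireLFunction_of_j_mem_maximalCMJInvariants) :
    ∀ (p : ℕ) [Fact p.Prime] [(⟨0, -8 * (p : ℚ), 0, 8 * (p : ℚ) ^ 2, 0⟩ : WeierstrassCurve ℚ).IsElliptic]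
      [(⟨0, -8 * (p : ℚ), 0, 8 * (p : ℚ) ^ 2, 0⟩ : WeierstrassCurve ℚ).IsGloballyMinimal]
      [NeZero ((⟨0, -8 * (p : ℚ), 0, 8 * (p : ℚ) ^ 2, 0⟩ : WeierstrassCurve ℚ).conductorNorm ℤ)],
      p % 8 = 5 → p ≠ 5 →
      (jacobiSym (p : ℤ) 7 = 1 ∨ jacobiSym (p : ℤ) 23 = 1 ∨ jacobiSym (p : ℤ) 71 = 1 ∨ jacobiSym (p : ℤ) 103 = 1 ∨
        jacobiSym (p : ℤ) 151 = 1) →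
      ∃ (K : Type) (_ : Field K) (_ : NumberField K),
        IsImaginaryQuadratic K ∧ 4 < (NumberField.discr K).natAbs ∧
        SatisfiesHeegnerHypothesis ((⟨0, -8 * (p : ℚ), 0, 8 * (p : ℚ) ^ 2, 0⟩ : WeierstrassCurve ℚ).conductorNorm ℤ) K ∧
        ((⟨0, -8 * (p : ℚ), 0, 8 * (p : ℚ) ^ 2, 0⟩ : WeierstrassCurve ℚ).quadraticTwist (NumberField.discr K : ℚ)).entireLFunction 1 ≠ 0 ∧
        NumberField.classNumber K < p ∧ ¬ p ∣ NumberField.classNumber K := by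
  intro p hpF _ _ _ hp8 h5 hJ
  have hp : p.Prime := hpF.out
  obtain ⟨h7, h23, h71, h103, h151⟩ := rootless_seven
  rcases hJ with hJ | hJ | hJ | hJ | hJ
  · obtain ⟨K, iF, iN, hK, -, h4, hHg, hL, hcl, hnd⟩ :=
      cruxOnBdualCornerPrime_of_two_facts hBT hH hp hp8 h5 (by norm_num) (by norm_num) (by norm_num) h7 hJ
    exact ⟨K, iF, iN, hK, h4, hHg, hL, hcl, hnd⟩
  · obtain ⟨K, iF, iN, hK, -, h4, hHg, hL, hcl, hnd⟩ :=
      cruxOnBdualCornerPrime_of_two_facts hBT hH hp hp8 h5 (by norm_num) (by norm_num) (by norm_num) h23 hJ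
    exact ⟨K, iF, iN, hK, h4, hHg, hL, hcl, hnd⟩
  · obtain ⟨K, iF, iN, hK, -, h4, hHg, hL, hcl, hnd⟩ :=
      cruxOnBdualCornerPrime_of_two_facts hBT hH hp hp8 h5 (by norm_num) (by norm_num) (by norm_num) h71 hJ
    exact ⟨K, iF, iN, hK, h4, hHg, hL, hcl, hnd⟩
  · obtain ⟨K, iF, iN, hK, -, h4, hHg, hL, hcl, hnd⟩ :=
      cruxOnBdualCornerPrime_of_two_facts hBT hH hp hp8 h5 (by norm_num) (by norm_num) (by norm_num) h103 hJ
    exact ⟨K, iF, iN, hK, h4, hHg, hL, hcl, hnd⟩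
  · obtain ⟨K, iF, iN, hK, -, h4, hHg, hL, hcl, hnd⟩ :=
      cruxOnBdualCornerPrime_of_two_facts hBT hH hp hp8 h5 (by norm_num) (by norm_num) (by norm_num) h151 hJ
    exact ⟨K, iF, iN, hK, h4, hHg, hL, hcl, hnd⟩

end Rungs

end Summit.BirchSwinnertonDyer.BirchSwinnertonDyer.Theorems.BiquadraticEisensteinDescentHeegnerTwistCouplingInSupplySqrtTwoDualSeven

end
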